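import Literature.Probability.Percolation.ZonesOwners
import Literature.Probability.Percolation.PortCountSq
import HarnessLib

/-!
# The owner count for the gluing zones with excised junction squares

Topic `Probability/Percolation`.  Support file (proofs, no named fact) for step (C) of the proof of
Schramm–Smirnov's Prop. 4.1 (Ann. Probab. 39 (2011), §4).  `ZonesOwners.lean` discharges the
hypotheses of the counting theorem for zones WITHOUT squares; here the same is done in the presence
of the excised junction squares `SQ` (the modification `ω̃` near the points `x_i` of the printed
proof), using the four-kind classification of `PortCountSq.lean`.  The geometric input, to be
supplied by the block geometry: every tube site has a non-square neighbour (`hNedge`), from every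
square corner of a face one reaches, through faces sharing square corners, a face with a tube-edge
side (`hSQesc`: the squares are attached to the tube), and the far sites are pairwise joined through
far sites (`hFar`: one far component).

* `tileData_farO_sq`, `tileData_examined_of_leaving_sq`, `tileData_package_sq` (terminality package
  and far connection);
* `exists_owners_zones_sq` — **the owners of the hub contacts are few**:
  `#R ≤ max 1 (2 · #landings + #sqSides)`.

## References

* O. Schramm, S. Smirnov, *On the scaling limits of planar percolation*, Ann. Probab. 39 (2011)
  1768–1814, arXiv:1101.5820, §4, proof of Prop. 4.1 (the modification `ω̃`; "the number of bays
  is bounded"). [SchrammSmirnov2011]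
-/

noncomputable section

open Set Relation
open Literature.Probability.LatticeModels
open scoped Classical

namespace Literature.Probability.Percolation

namespace Seeded

namespace Zones

open CellComplex TileData

variable (𝒵 : Zones) {X : Finset (Sym2 (Site 2))} {ω : BondConfig (Site 2)}
  (hT : IsTerminal 𝒵.seeds X ω) (hN : 𝒵.Nice)
  (hNedge : ∀ n ∈ 𝒵.N, ∃ k : Fin 4, n + cornerUnit k ∉ 𝒵.SQ)
  (hSQesc : ∀ q ∈ 𝒵.SQ, ∀ f, TouchesFace q f →
    ∃ g, (∃ e ∈ 𝒵.tubeEdges, IsFaceOf g e) ∧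
      ReflTransGen (fun a b => ∃ u, TouchesFace u a ∧ TouchesFace u b ∧ u ∈ 𝒵.SQ) f g)
  (hFar : ∀ u ∈ 𝒵.Far, ∀ u' ∈ 𝒵.Far,
    ReflTransGen (fun a b => a ∈ 𝒵.Far ∧ b ∈ 𝒵.Far ∧ (zdGraph 2).Adj a b) u u')

/-- A vertex outside the window is far or excised. [folklore] -/
theorem mem_Far_or_SQ_of_not_mem_Wv {u : Site 2} (hu : u ∉ 𝒵.Wv) : u ∈ 𝒵.Far ∨ u ∈ 𝒵.SQ := by
  by_cases h : u ∈ 𝒵.SQ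
  · exact Or.inr h
  · exact Or.inl ⟨fun h' => hu (Or.inl h'), fun h' => hu (Or.inr h'), h⟩

include hT in
/-- Hub vertices are not excised. [folklore] -/
theorem not_mem_SQ_of_oReach {v : Site 2} (hv : OReach 𝒵.seeds X ω v) : v ∉ 𝒵.SQ := fun hS => by
  rcases 𝒵.mem_K_or_Far_of_oReach hT hv with hK | hF
  · exact Finset.disjoint_left.1 𝒵.disjoint_K_SQ hK hS
  · exact hF.2.2 hS

/-- **Every vertex outside the window is a hub vertex or an excised site.** [folklore] -/
theorem tileData_farO_sq : ∀ u, u ∉ (𝒵.tileData hT hN).Wv → u ∈ (𝒵.tileData hT hN).O ∨ u ∈ 𝒵.SQ := by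
  intro u hu
  rcases 𝒵.mem_Far_or_SQ_of_not_mem_Wv hu with h | h
  · exact Or.inl (oReach_of_mem_seeds X ω h)
  · exact Or.inr h

/-- Excised sites are outside the window. [folklore] -/
theorem not_mem_Wv_of_mem_SQ : ∀ q ∈ 𝒵.SQ, q ∉ (𝒵.tileData hT hN).Wv := by
  rintro q hq (h | h)
  · exact Finset.disjoint_left.1 𝒵.disjoint_K_SQ h hq
  · exact Finset.disjoint_left.1 𝒵.disjoint_N_SQ h hq

/-- Excised sites are not hub vertices. [folklore] -/
theorem not_mem_O_of_mem_SQ : ∀ q ∈ 𝒵.SQ, q ∉ (𝒵.tileData hT hN).O :=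
  fun _ hq hO => 𝒵.not_mem_SQ_of_oReach hT hO hq

/-- **Every edge leaving the window is examined or touches a square** (terminality at a far
endpoint). [folklore] -/
theorem tileData_examined_of_leaving_sq : ∀ e ∈ (zdGraph 2).edgeSet, (∃ v ∈ e, v ∈ (𝒵.tileData hT hN).Wv) →
    (∃ u ∈ e, u ∉ (𝒵.tileData hT hN).Wv) →
    e ∈ (𝒵.tileData hT hN).hubE ∨ e ∈ (𝒵.tileData hT hN).clE ∨ ∃ q ∈ e, q ∈ 𝒵.SQ := by
  rintro e heE ⟨v, hve, hvW⟩ ⟨u, hue, huW⟩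
  rcases 𝒵.mem_Far_or_SQ_of_not_mem_Wv huW with huF | huS
  swap
  · exact Or.inr (Or.inr ⟨u, hue, huS⟩)
  have hvu : v ≠ u := fun h => huW (h ▸ hvW)
  have he : e = s(v, u) := (Sym2.mem_and_mem_iff hvu).1 ⟨hve, hue⟩
  have hvK : v ∈ 𝒵.K := by
    rcases hvW with hK | hvN
    · exact hK
    · exfalso
      have hadj : (zdGraph 2).Adj v u := (SimpleGraph.mem_edgeSet (G := zdGraph 2)).1 (he ▸ heE)
      obtain ⟨k, rfl⟩ := adj_iff_exists_cornerUnit.1 hadj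
      rcases hN.N_nbr v hvN k with h | h | h
      · exact huW (Or.inl h)
      · exact huW (Or.inr h)
      · exact huF.2.2 h
  have heA : e ∈ 𝒵.collar.A := by
    refine 𝒵.collar.mem_A_iff.2 ⟨heE, ⟨v, hve, hvK⟩, fun w hw => ?_⟩
    rw [he] at hw
    rcases Sym2.mem_iff.1 hw with rfl | rfl
    · exact Or.inl hvK
    · exact Or.inr huF
  by_cases heX : e ∈ X
  · by_cases heω : e ∈ ω
    · exact Or.inl ⟨heX, heω⟩
    · exact Or.inr (Or.inl ⟨heX, heω⟩)
  · exfalso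
    refine hT.not_eligible e ⟨heA, heX, ⟨u, hue, oReach_of_mem_seeds X ω huF⟩, ?_⟩
    obtain ⟨a, b, -, hab⟩ := exists_dualEdge_eq_mk heE
    refine ⟨a, isFaceOf_left_of_dualEdge_eq hab, dReach_of_mem_seeds X ω ?_⟩
    exact ⟨u, touchesFace_of_isFaceOf heE (isFaceOf_left_of_dualEdge_eq hab) hue, huF⟩

include hNedge hSQesc in
/-- **The terminality package of the tile data of the zones with squares.** [folklore] -/
private theorem tileData_terminal_sq : (𝒵.tileData hT hN).Terminal where
  far_wet v f hvO hvW hvf := by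
    rcases 𝒵.mem_Far_or_SQ_of_not_mem_Wv hvW with hF | hS
    · exact dReach_of_mem_seeds X ω ⟨v, hvf, hF⟩
    · exact absurd hS (𝒵.not_mem_SQ_of_oReach hT hvO)
  dry_finite := by
    refine (Finset.finite_toSet (𝒵.K ∪ 𝒵.N ∪ 𝒵.SQ)).subset fun f hf => ?_
    by_contra hfW
    have hfFar : f ∈ 𝒵.Far := by
      refine ⟨fun h => hfW ?_, fun h => hfW ?_, fun h => hfW ?_⟩
      · exact Finset.mem_union_left _ (Finset.mem_union_left _ h)
      · exact Finset.mem_union_left _ (Finset.mem_union_right _ h)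
      · exact Finset.mem_union_right _ h
    refine hf (dReach_of_mem_seeds X ω ⟨f, ?_, hfFar⟩)
    have h := TileData.touchesFace_add_cornerOff f 0
    rwa [show cornerOff 0 = 0 from rfl, add_zero] at h
  wet_dry e heE hO hwet hdry := by
    by_cases heX : e ∈ X
    · by_cases heω : e ∈ ω
      · exact Or.inl ⟨heX, heω⟩
      · exact Or.inr (Or.inl ⟨heX, heω⟩)
    right; right
    by_cases heA : e ∈ 𝒵.collar.A
    · exact absurd ⟨heA, heX, hO, hwet⟩ (hT.not_eligible e)
    · by_cases hNe : ∃ w ∈ e, w ∈ 𝒵.N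
      · obtain ⟨w, hwe, hwN⟩ := hNe
        refine ⟨w, hwe, 𝒵.not_oReach_of_mem_N hT hwN, Or.inr ?_⟩
        -- a tube edge at `w` towards a non-square neighbour
        obtain ⟨k, hk⟩ := hNedge w hwN
        have ht : dartEdge w k ∈ 𝒵.tubeEdges := by
          refine 𝒵.mem_tubeEdges_iff.2 ⟨dartEdge_mem_edgeSet _ _, ⟨w, mem_dartEdge_iff.2 (Or.inl rfl), hwN⟩, fun v hv => ?_⟩
          rcases mem_dartEdge_iff.1 hv with rfl | rfl
          · exact fun h => Finset.disjoint_left.1 𝒵.disjoint_N_SQ hwN h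
          · exact hk
        exact ⟨dartEdge w k, Finset.mem_filter.2 ⟨𝒵.mem_fresh_iff.2 (Or.inr ht), 𝒵.acc_of_mem_tubeEdges ht⟩,
          mem_dartEdge_iff.2 (Or.inl rfl)⟩
      · push Not at hNe
        by_cases hSe : ∃ w ∈ e, w ∈ 𝒵.SQ
        · obtain ⟨w, hwe, hwS⟩ := hSe
          exact ⟨w, hwe, 𝒵.not_mem_O_of_mem_SQ hT hN w hwS, Or.inl (𝒵.not_mem_Wv_of_mem_SQ hT hN w hwS)⟩
        · push Not at hSe
          exfalso
          have hKF : ∀ w ∈ e, w ∈ 𝒵.K ∨ w ∈ 𝒵.Far := by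
            intro w hw
            by_cases hK : w ∈ 𝒵.K
            · exact Or.inl hK
            · exact Or.inr ⟨hK, hNe w hw, hSe w hw⟩
          have hnoK : ∀ w ∈ e, w ∉ 𝒵.K := by
            intro w hw hwK
            exact heA (𝒵.collar.mem_A_iff.2 ⟨heE, ⟨w, hw, hwK⟩, hKF⟩)
          obtain ⟨m, hme, hmD⟩ := hdry
          refine hmD (dReach_of_mem_seeds X ω ?_)
          obtain ⟨w, hw⟩ : ∃ w, w ∈ e := ⟨_, Sym2.out_fst_mem e⟩
          exact ⟨w, touchesFace_of_isFaceOf heE hme hw, (hKF w hw).resolve_left (hnoK w hw)⟩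
  esc_dry f _ w hwf hwW hwO := by
    -- `w` is excised (far sites are hub vertices): chain through square corners to the tube
    have hwS : w ∈ 𝒵.SQ := (𝒵.mem_Far_or_SQ_of_not_mem_Wv hwW).resolve_left fun hF => hwO (oReach_of_mem_seeds X ω hF)
    obtain ⟨g, ⟨e, he, hge⟩, hchain⟩ := hSQesc w hwS f hwf
    refine ⟨g, ⟨e, Finset.mem_filter.2 ⟨𝒵.mem_fresh_iff.2 (Or.inr he), 𝒵.acc_of_mem_tubeEdges he⟩, hge⟩, ?_⟩
    refine reflTransGen_of_imp (fun a b ⟨u, hua, hub, huS⟩ => ?_) hchain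
    exact ⟨u, hua, hub, 𝒵.not_mem_Wv_of_mem_SQ hT hN u huS, 𝒵.not_mem_O_of_mem_SQ hT hN u huS⟩

include hFar in
/-- **The far connection** with one far component: the far walk avoids the squares. [folklore] -/
private theorem tileData_hfar_sq : ∀ c c' u₁ u₂ : Site 2, c ∈ (𝒵.tileData hT hN).O → c' ∈ (𝒵.tileData hT hN).O →
    (∃ f, TouchesFace c f ∧ TouchesFace c' f) → u₁ ∉ (𝒵.tileData hT hN).Wv → u₂ ∉ (𝒵.tileData hT hN).Wv →
    ReflTransGen (fun a b => s(a, b) ∈ (𝒵.tileData hT hN).hubE) c u₁ →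
    ReflTransGen (fun a b => s(a, b) ∈ (𝒵.tileData hT hN).hubE) c' u₂ →
    ReflTransGen (TileData.FarAdj (𝒵.tileData hT hN)) u₂ u₁ := by
  intro c c' u₁ u₂ hcO hc'O _ hu₁ hu₂ h₁ h₂
  set 𝒯 := 𝒵.tileData hT hN with h𝒯
  -- the endpoint of an examined open path from a hub vertex is a hub vertex, hence far (not excised)
  have endO : ∀ {a b : Site 2}, a ∈ 𝒯.O → ReflTransGen (fun a b => s(a, b) ∈ 𝒯.hubE) a b → b ∈ 𝒯.O := by
    intro a b ha h
    induction h with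
    | refl => exact ha
    | tail _ hst _ => exact 𝒯.hub_O _ hst _ (Sym2.mem_mk_right _ _)
  have hu₁F : u₁ ∈ 𝒵.Far :=
    (𝒵.mem_Far_or_SQ_of_not_mem_Wv hu₁).resolve_right (𝒵.not_mem_SQ_of_oReach hT (endO hcO h₁))
  have hu₂F : u₂ ∈ 𝒵.Far :=
    (𝒵.mem_Far_or_SQ_of_not_mem_Wv hu₂).resolve_right (𝒵.not_mem_SQ_of_oReach hT (endO hc'O h₂))
  have farStep : ∀ {a b : Site 2}, a ∈ 𝒵.Far → b ∈ 𝒵.Far → (zdGraph 2).Adj a b → TileData.FarAdj 𝒯 a b :=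
    fun ha hb hab => ⟨hab, oReach_of_mem_seeds X ω ha, 𝒵.not_mem_Wv_of_mem_Far ha, oReach_of_mem_seeds X ω hb,
      𝒵.not_mem_Wv_of_mem_Far hb⟩
  have key : ∀ {b}, ReflTransGen (fun a b => a ∈ 𝒵.Far ∧ b ∈ 𝒵.Far ∧ (zdGraph 2).Adj a b) u₂ b →
      ReflTransGen (TileData.FarAdj 𝒯) u₂ b := by
    intro b h
    induction h with
    | refl => exact ReflTransGen.refl
    | tail _ hab ih => exact ih.tail (farStep hab.1 hab.2.1 hab.2.2)
  exact key (hFar u₂ hu₂F u₁ hu₁F)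

include hNedge hSQesc hFar in
/-- **The hypotheses of the port theory for the zones with squares**: the terminality package and the
far connection, bundled (for `PortCountSq`, `PortChainSq`). [folklore] -/
theorem tileData_package_sq : (𝒵.tileData hT hN).Terminal ∧
    ∀ c c' u₁ u₂ : Site 2, c ∈ (𝒵.tileData hT hN).O → c' ∈ (𝒵.tileData hT hN).O →
      (∃ f, TouchesFace c f ∧ TouchesFace c' f) → u₁ ∉ (𝒵.tileData hT hN).Wv → u₂ ∉ (𝒵.tileData hT hN).Wv →
      ReflTransGen (fun a b => s(a, b) ∈ (𝒵.tileData hT hN).hubE) c u₁ →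
      ReflTransGen (fun a b => s(a, b) ∈ (𝒵.tileData hT hN).hubE) c' u₂ →
      ReflTransGen (TileData.FarAdj (𝒵.tileData hT hN)) u₂ u₁ :=
  ⟨𝒵.tileData_terminal_sq hT hN hNedge hSQesc, 𝒵.tileData_hfar_sq hT hN hFar⟩

include hNedge hSQesc hFar in
/-- **The owners of the hub contacts of the zones' link domain are few** (with excised squares): at
most `max 1 (2 · #landings + #sqSides)` hubs own all the hub contacts of a traced boundary loop.
[cite: SchrammSmirnov2011, §4, proof of Prop. 4.1 ("the number of bays is bounded")] -/
theorem exists_owners_zones_sq {d₀ : Site 2 × Fin 4} (h₀ : IsBd (𝒵.tileData hT hN).U d₀) :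
    ∃ R : Finset (Site 2), R.card ≤ max 1 (2 * ((𝒵.tileData hT hN).landings).card +
        ((𝒵.tileData hT hN).sqSides d₀ (↑𝒵.SQ : Set (Site 2)) h₀).card) ∧
      ∀ i, (𝒵.tileData hT hN).hubContact d₀ i → ∀ v ∈ (𝒵.tileData hT hN).att ((𝒵.tileData hT hN).outCell d₀ i),
        ∃ r ∈ R, (𝒵.tileData hT hN).HubConn v r :=
  TileData.exists_owners_sq (SQ := (↑𝒵.SQ : Set (Site 2))) (fun q hq => 𝒵.not_mem_Wv_of_mem_SQ hT hN q hq)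
    (fun q hq => 𝒵.not_mem_O_of_mem_SQ hT hN q hq) (𝒵.tileData_terminal_sq hT hN hNedge hSQesc)
    (𝒵.tileData_farO_sq hT hN) (𝒵.tileData_examined_of_leaving_sq hT hN) h₀ (𝒵.tileData_hdisj hT hN)
    (𝒵.tileData_hfar_sq hT hN hFar)

end Zones

end Seeded

end Literature.Probability.Percolation

end
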